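import Mathlib.Topology.Algebra.Valued.NormedValued
import Mathlib.NumberTheory.Padics.RingHoms
import Literature.NumberTheory.EllipticCurves.ComplexMultiplicationCoatesWilesSahProofs
import Literature.NumberTheory.EllipticCurves.GeomPointReduction
import Literature.NumberTheory.EllipticCurves.MinimalModelReduction
import Literature.NumberTheory.EllipticCurves.PadicPointsFiltration
import HarnessLib

/-!
# Coates–Wiles, proof of Lemma 35: `β E(ℚ_p) ⊆ E₁(ℚ_p)` with `β = #Ẽ(𝔽_p)` prime to `p` at a
# non-anomalous prime

Sibling *proofs* file (theorems only: no definition, no named fact, no instance) of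
`ComplexMultiplicationCoatesWiles.lean` for the named fact
`Literature.NumberTheory.EllipticCurves.CoatesWiles1977_L_one_div_period_mem_prime`
(J. Coates, A. Wiles, Invent. Math. **39** (1977), §6 p. 250). The proof of **Lemma 35** opens
(p. 250): *"Let `E₁(K_𝔭)` be the kernel of reduction modulo `𝔭` on `E(K_𝔭)`. The index of
`E₁(K_𝔭)` in `E(K_𝔭)` is finite because (1) has a good reduction modulo `𝔭`. Moreover, as the
reduction of the endomorphism `π` of `E` is the Frobenius endomorphism of `E` modulo `𝔭` (so that
`π` has trivial kernel on `E` mod `𝔭`), it follows that we can choose `β ≠ 0` in `𝓞` such that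
`(β, π) = 1` and `βE(K_𝔭) ⊆ E₁(K_𝔭)`. Further, `βP` is not the zero element of `E₁(K_𝔭)`,
because `P` has infinite order."*

For `F = ℚ` and `p = 𝔭𝔭̄` split, `K_𝔭 = ℚ_p`, and under good reduction the reduction map
`E(ℚ_p) → Ẽ(𝔽_p)` is a homomorphism on all of `E(ℚ_p)` with kernel `E₁(ℚ_p)` (Silverman, *AEC*
VII.2.1; the tree's `Literature.NumberTheory.EllipticCurves.goodReductionHom`,
`goodReductionHom_eq_zero_iff`, `GeomPointReduction.lean`), so **`β = #Ẽ(𝔽_p)` works**: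
`β · Q̃ = Õ` for every `Q`. At the primes of the fact — `p > 7` of good reduction and **not
anomalous**, `a_p ≠ 1` — this `β = p + 1 - a_p` is moreover **prime to `p`** (for `p > 5`,
`a_p ≡ 1 (mod p) ⇔ a_p = 1` by Hasse, the tree's
`CoatesWiles1977.frobeniusTrace_modEq_one_iff`), hence prime to `π`: the printed `(β, π) = 1`,
obtained here from the non-anomalous hypothesis instead of Deuring's "`π` reduces to Frobenius"
(which gives it at every split prime and is not formalised). Contents:

* `Literature.NumberTheory.EllipticCurves.padicInt_valuationIntegers` — `ℤ_p` is the ring of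
  integers of the norm valuation of `ℚ_p` (the `hv : v.Integers R` input of the tree's reduction
  files, for `R = ℤ_[p]`, `K = ℚ_[p]`);
* `WeierstrassCurve.reducesToZero_iff_isInReductionKernel` — the kernel of reduction of
  `ReductionHomomorphism.lean` (`x ∉ ℤ_p`) is the `E₁(ℚ_p)` of `FormalGroup.lean` (`‖x‖ > 1`);
* `WeierstrassCurve.isInReductionKernel_card_nsmul` — **`#Ẽ(𝔽_p) · E(ℚ_p) ⊆ E₁(ℚ_p)`** for every
  `V/ℤ_p` with unit discriminant;
* over `ℚ`, for a globally minimal elliptic `W` and a good prime `p ∤ Δ_W`: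
  `WeierstrassCurve.padicModel_baseChange` (`W ⊗ ℚ_p` is the base change of the `ℤ_p`-model
  `integralModelInt W ⊗ ℤ_p`), `WeierstrassCurve.isUnit_Δ_padicModel`,
  `WeierstrassCurve.natCard_point_padicModel_residue` (**its reduction has `reductionPointCount W p`
  points**, the count defining `a_p = frobeniusTrace W p`; transport along
  `PadicInt.residueField : 𝓞/𝔪 ≃ ℤ/p` by the tree's `WeierstrassCurve.natCard_point_map_ringEquiv`),
  whence
  `WeierstrassCurve.isInReductionKernel_reductionPointCount_nsmul`:
  **`N_p · E(ℚ_p) ⊆ E₁(ℚ_p)`**, `N_p = p + 1 - a_p`;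
* `CoatesWiles1977.not_dvd_reductionPointCount_of_frobeniusTrace_ne_one` — for `p > 5` good and
  not anomalous, `p ∤ N_p`;
* `CoatesWiles1977.exists_coprime_nsmul_toPadicPoint` — **the opening of the proof of Lemma 35
  with `(β, p) = 1`**: for `P ∈ E(ℚ)` of infinite order and `p > 5` good, non-anomalous,
  `β = N_p` is prime to `p`, `βE(ℚ_p) ⊆ E₁(ℚ_p)`, and `α = β·ι(P) ∈ E₁(ℚ_p)` is non-zero of
  infinite order.

## References

* J. Coates, A. Wiles, *On the conjecture of Birch and Swinnerton-Dyer*, Invent. Math. 39 (1977),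
  §6 p. 250 (proof of Lemma 35); §3 p. 231 (Definition of anomalous primes, Lemma 12).
  [CoatesWiles1977]
* J. H. Silverman, *The Arithmetic of Elliptic Curves*, 2nd ed., GTM 106 (2009): VII.2.1, VII.2.2,
  V.1.1 (Hasse). [SilvermanAEC2009]

## Design notes

* Pure proofs file: no `def`, no named fact, no instance; net debt delta `0`. No finiteness of
  `Ẽ(𝔽_p)` is needed: `Nat.card G • g = 0` holds in every group (`card_nsmul_eq_zero'`), and
  positivity of the count is the tree's `reductionPointCount_pos`.
* The `ℤ_p`-model of `W` is written out as `(integralModelInt W).map (Int.castRingHom ℤ_[p])`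
  (no abbreviation is introduced); all identifications of models are `map_map` + `RingHom.ext_int`.
-/

noncomputable section

open scoped Classical NNReal

namespace Literature.NumberTheory.EllipticCurves

/-! ### `ℤ_p` as valuation integers -/

/-- `ℤ_p ⊂ ℚ_p` is the ring of integers of the norm valuation `‖·‖₊` of `ℚ_p` (the input
`hv : v.Integers R` of `ReductionHomomorphism.lean` / `GeomPointReduction.lean`). [folklore] -/
theorem padicInt_valuationIntegers (p : ℕ) [Fact p.Prime] :
    (NormedField.valuation (K := ℚ_[p])).Integers ℤ_[p] where
  hom_inj := fun x y h => Subtype.ext h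
  map_le_one x := by
    change ‖(x : ℚ_[p])‖₊ ≤ 1
    rw [← NNReal.coe_le_coe, coe_nnnorm, NNReal.coe_one]
    exact x.2
  exists_of_le_one r hr := by
    change ‖r‖₊ ≤ 1 at hr
    rw [← NNReal.coe_le_coe, coe_nnnorm, NNReal.coe_one] at hr
    exact ⟨⟨r, hr⟩, rfl⟩

end Literature.NumberTheory.EllipticCurves

namespace WeierstrassCurve

open Literature.NumberTheory.EllipticCurves

/-! ### Over `ℤ_p`: `#Ẽ(𝔽_p) · E(ℚ_p) ⊆ E₁(ℚ_p)` under good reduction -/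

section PadicInt

variable {p : ℕ} [Fact p.Prime] (V : WeierstrassCurve ℤ_[p])

/-- The two kernels of reduction agree: `ReducesToZero V P` (`x(P) ∉ ℤ_p`,
`ReductionHomomorphism.lean`) iff `P ∈ E₁(ℚ_p)` in the sense of `FormalGroup.lean`
(`‖x(P)‖ > 1`). [Silverman AEC VII.2] [folklore] -/
theorem reducesToZero_iff_isInReductionKernel (P : (V.baseChange ℚ_[p]).toAffine.Point) :
    ReducesToZero V P ↔ (V.baseChange ℚ_[p]).IsInReductionKernel P := by
  rcases P with _ | ⟨x, y, h⟩
  · exact ⟨fun _ => (V.baseChange ℚ_[p]).isInReductionKernel_zero, fun _ => reducesToZero_zero⟩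
  · rw [reducesToZero_some_iff, isInReductionKernel_some, ← not_le, not_iff_not]
    constructor
    · rintro ⟨z, rfl⟩
      exact z.2
    · intro hx
      exact ⟨⟨x, hx⟩, rfl⟩

/-- **`#Ẽ(𝔽_p) · E(ℚ_p) ⊆ E₁(ℚ_p)`** for a Weierstrass equation over `ℤ_p` with unit discriminant
(good reduction): the reduction `E(ℚ_p) → Ẽ(𝔽_p)` is a homomorphism with kernel `E₁(ℚ_p)`
(AEC VII.2.1, the tree's `goodReductionHom`), and `#Ẽ(𝔽_p)` kills `Ẽ(𝔽_p)`. This is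
Coates–Wiles' "`βE(K_𝔭) ⊆ E₁(K_𝔭)`" with the explicit `β = #Ẽ(𝔽_p)`.
[Silverman AEC VII.2.1] [cite: CoatesWiles1977, §6 p. 250 (proof of Lemma 35)] -/
theorem isInReductionKernel_card_nsmul (hΔ : IsUnit V.Δ) (Q : (V.baseChange ℚ_[p]).toAffine.Point) :
    (V.baseChange ℚ_[p]).IsInReductionKernel
      (Nat.card (V.map (IsLocalRing.residue ℤ_[p])).toAffine.Point • Q) := by
  set r := goodReductionHom V (padicInt_valuationIntegers p) hΔ with hr
  have h0 : r (Nat.card (V.map (IsLocalRing.residue ℤ_[p])).toAffine.Point • Q) = 0 := by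
    rw [map_nsmul, card_nsmul_eq_zero']
  exact (V.reducesToZero_iff_isInReductionKernel _).1
    ((goodReductionHom_eq_zero_iff (padicInt_valuationIntegers p) hΔ _).1 h0)

end PadicInt

/-! ### Over `ℚ`: the `ℤ_p`-model of a globally minimal equation and its point count -/

section Rat

variable (W : WeierstrassCurve ℚ) [W.IsGloballyMinimal] (p : ℕ) [Fact p.Prime]

/-- `W ⊗ ℚ_p` is the base change of the `ℤ_p`-model `integralModelInt W ⊗ ℤ_p`. [folklore] -/
theorem padicModel_baseChange :
    ((integralModelInt W).map (Int.castRingHom ℤ_[p])).baseChange ℚ_[p] = W.baseChange ℚ_[p] := by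
  conv_rhs => rw [← map_integralModelInt W]
  rw [baseChange, baseChange, map_map, map_map]
  exact congrArg (integralModelInt W).map (RingHom.ext_int _ _)

/-- At a prime `p ∤ Δ_W` the `ℤ_p`-model has unit discriminant. [folklore] -/
theorem isUnit_Δ_padicModel (hΔ : ¬ (p : ℤ) ∣ minimalDiscriminantInt W) :
    IsUnit ((integralModelInt W).map (Int.castRingHom ℤ_[p])).Δ := by
  rw [map_Δ, PadicInt.isUnit_iff]
  refine le_antisymm (PadicInt.norm_le_one _) (not_lt.1 fun hlt => hΔ ?_)
  exact (PadicInt.norm_int_lt_one_iff_dvd _).1 hlt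

/-- **The reduction of the `ℤ_p`-model has `reductionPointCount W p` points** (the count
`N_p = #Ẽ(𝔽_p)` entering `a_p = frobeniusTrace W p = p + 1 - N_p`): the residue field of `ℤ_p`
is `ℤ/p` (`PadicInt.residueField`) and both reductions are `integralModelInt W` read in `ℤ/p`.
[folklore] -/
theorem natCard_point_padicModel_residue :
    Nat.card (((integralModelInt W).map (Int.castRingHom ℤ_[p])).map
        (IsLocalRing.residue ℤ_[p])).toAffine.Point = reductionPointCount W p := by
  have hcurve : (((integralModelInt W).map (Int.castRingHom ℤ_[p])).map
      (IsLocalRing.residue ℤ_[p])).map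
        (PadicInt.residueField (p := p) : IsLocalRing.ResidueField ℤ_[p] →+* ZMod p) =
      (integralModelInt W).map (Int.castRingHom (ZMod p)) := by
    rw [map_map, map_map]
    exact congrArg (integralModelInt W).map (RingHom.ext_int _ _)
  rw [reductionPointCount, ← hcurve]
  exact (natCard_point_map_ringEquiv (PadicInt.residueField (p := p)) _).symm

/-- **`N_p · E(ℚ_p) ⊆ E₁(ℚ_p)`** for a globally minimal `W/ℚ` and a good prime `p ∤ Δ_W`, with
`N_p = reductionPointCount W p = #Ẽ(𝔽_p) = p + 1 - a_p` — Coates–Wiles' "`βE(K_𝔭) ⊆ E₁(K_𝔭)`"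
(p. 250) with `β = N_p`. [Silverman AEC VII.2.1]
[cite: CoatesWiles1977, §6 p. 250 (proof of Lemma 35)] -/
theorem isInReductionKernel_reductionPointCount_nsmul (hΔ : ¬ (p : ℤ) ∣ minimalDiscriminantInt W)
    (Q : (W.baseChange ℚ_[p]).toAffine.Point) :
    (W.baseChange ℚ_[p]).IsInReductionKernel (reductionPointCount W p • Q) := by
  have key := fun Q => ((integralModelInt W).map (Int.castRingHom ℤ_[p])).isInReductionKernel_card_nsmul
    (W.isUnit_Δ_padicModel p hΔ) Q
  rw [W.natCard_point_padicModel_residue p, W.padicModel_baseChange p] at key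
  exact key Q

end Rat

end WeierstrassCurve

namespace Literature.NumberTheory.EllipticCurves

namespace CoatesWiles1977

/-- **At a non-anomalous prime `p > 5` of good reduction, `p ∤ N_p = #Ẽ(𝔽_p)`**: indeed
`a_p = p + 1 - N_p`, so `p ∣ N_p ⇔ a_p ≡ 1 (mod p) ⇔ a_p = 1` (Hasse, `frobeniusTrace_modEq_one_iff`),
i.e. `p` anomalous (Coates–Wiles, Definition p. 231). Hence `β = N_p` is prime to `p`, so to `π`:
the printed "`(β, π) = 1`" of the proof of Lemma 35 at the primes of the fact.
[cite: CoatesWiles1977, §3 p. 231 (Definition, Lemma 12) and §6 p. 250 (proof of Lemma 35)] -/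
theorem not_dvd_reductionPointCount_of_frobeniusTrace_ne_one (W : WeierstrassCurve ℚ)
    [W.IsElliptic] [W.IsGloballyMinimal] {p : ℕ} (hp : p.Prime) (h5 : 5 < p)
    (hΔ : ¬ (p : ℤ) ∣ WeierstrassCurve.minimalDiscriminantInt W) (hna : W.frobeniusTrace p ≠ 1) :
    ¬ p ∣ WeierstrassCurve.reductionPointCount W p := by
  intro hdvd
  refine (frobeniusTrace_ne_one_iff_not_modEq W hp h5 hΔ).1 hna ?_
  rw [WeierstrassCurve.frobeniusTrace, Int.modEq_iff_dvd]
  have h1 : (1 : ℤ) - ((p : ℤ) + 1 - (WeierstrassCurve.reductionPointCount W p : ℤ)) =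
      (WeierstrassCurve.reductionPointCount W p : ℤ) - p := by ring
  rw [h1]
  exact dvd_sub (Int.natCast_dvd_natCast.2 hdvd) dvd_rfl

/-- **The opening of the proof of Lemma 35, with `(β, p) = 1`** (Coates–Wiles p. 250: "we can
choose `β ≠ 0` in `𝓞` such that `(β, π) = 1` and `βE(K_𝔭) ⊆ E₁(K_𝔭)`. Further, `βP` is not the
zero element of `E₁(K_𝔭)`, because `P` has infinite order"), for `F = ℚ`, `K_𝔭 = ℚ_p` at a prime
`p > 5` of good reduction which is not anomalous (as in
`CoatesWiles1977_L_one_div_period_mem_prime`): with `β = N_p = #Ẽ(𝔽_p)`, `p ∤ β`,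
`βE(ℚ_p) ⊆ E₁(ℚ_p)`, and for `P ∈ E(ℚ)` of infinite order `α = β·ι(P) ∈ E₁(ℚ_p)` is non-zero of
infinite order (`ι = WeierstrassCurve.toPadicPoint`, injective). The coprimality comes here from
the non-anomalous hypothesis; Coates–Wiles get `(β, π) = 1` at every split prime from "the
reduction of `π` is the Frobenius endomorphism", which is not formalised.
[cite: CoatesWiles1977, §6 p. 250 (proof of Lemma 35)] -/
theorem exists_coprime_nsmul_toPadicPoint (W : WeierstrassCurve ℚ) [W.IsElliptic]
    [W.IsGloballyMinimal] {p : ℕ} [Fact p.Prime] (h5 : 5 < p)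
    (hΔ : ¬ (p : ℤ) ∣ WeierstrassCurve.minimalDiscriminantInt W) (hna : W.frobeniusTrace p ≠ 1)
    {P : W.toAffine.Point} (hP : ¬ IsOfFinAddOrder P) :
    ∃ β : ℕ, 0 < β ∧ ¬ p ∣ β ∧
      (∀ Q : (W.baseChange ℚ_[p]).toAffine.Point,
        (W.baseChange ℚ_[p]).IsInReductionKernel (β • Q)) ∧
      (W.baseChange ℚ_[p]).IsInReductionKernel (β • W.toPadicPoint p P) ∧
      β • W.toPadicPoint p P ≠ 0 ∧ ¬ IsOfFinAddOrder (β • W.toPadicPoint p P) := by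
  have hβ : 0 < WeierstrassCurve.reductionPointCount W p := W.reductionPointCount_pos p
  have hfin : ¬ IsOfFinAddOrder (WeierstrassCurve.reductionPointCount W p • W.toPadicPoint p P) := by
    rw [isOfFinAddOrder_nsmul]
    push Not
    refine ⟨fun h => hP ?_, hβ.ne'⟩
    exact (Function.Injective.isOfFinAddOrder_iff (f := W.toPadicPoint p)
      (WeierstrassCurve.Affine.Point.map_injective (W' := W.toAffine)
        (f := Algebra.ofId ℚ ℚ_[p]))).1 h
  refine ⟨WeierstrassCurve.reductionPointCount W p, hβ,
    not_dvd_reductionPointCount_of_frobeniusTrace_ne_one W (Fact.out) h5 hΔ hna,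
    W.isInReductionKernel_reductionPointCount_nsmul p hΔ,
    W.isInReductionKernel_reductionPointCount_nsmul p hΔ _, fun h0 => hfin ?_, hfin⟩
  rw [h0]
  exact IsOfFinAddOrder.zero

end CoatesWiles1977

end Literature.NumberTheory.EllipticCurves
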